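import Literature.Algebra.EuclideanLattices.LatticeGapNPcoNPLemmaA1
import Literature.Algebra.EuclideanLattices.ProblemsProofs
import Literature.Computability.Complexity.IntVectorBricks
import Mathlib.Data.Int.Lemmas
import Mathlib.LinearAlgebra.Matrix.AbsoluteValue
import HarnessLib

/-!
# `GapSVP_γ ∈ NP` for `γ ≥ 1`: the verifier "`‖z B‖ ≤ d`" in `P`, discharge of `gapSVP_mem_promiseNP`

Topic `Algebra/EuclideanLattices` (family `pqc`), sibling proof file of `LatticeGapNPcoNP.lean`
(D-0014: the named fact `Literature.Algebra.EuclideanLattices.gapSVP_mem_promiseNP : Prop` stays a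
`def` there and is discharged here as `gapSVP_mem_promiseNP_holds`). This is the first leaf of
the decomposition of Aharonov–Regev 2005, Cor. 1.2 (`gapSVP_sqrt_mem_promiseNP_inter_promiseCoNP`
of `LatticeComplexity.lean`); with Lemma A.1 (`LatticeGapNPcoNPLemmaA1.lean`) it reduces Cor. 1.2
to the coNP part of Thm. 1.1 alone (`gapSVP_sqrt_mem_promiseNP_inter_promiseCoNP_of_coNP_part`).

## The printed statement

D. Aharonov, O. Regev, *Lattice problems in NP ∩ coNP*, J. ACM 52 (2005), p. 2 (authors'
version, `lit read paper:doi-10-1109-focs-2004-35`): "We note that containment in NP is trivial,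
and the difficult part is showing the containment in coNP"; O. Regev, in Nguyễn–Vallée (eds.),
*The LLL Algorithm* (2010), Ch. 15, p. 477: "a witness for `dist(v, L(B)) ≤ d` is simply a vector
`u ∈ L(B)` such that `‖v − u‖ ≤ d`" — for `GapSVP`: a nonzero `u = z B ∈ L(B)` with `‖u‖ ≤ d`.

## The Lean proof (machine level: Mathlib's `TM2` through the tree's `FP` algebra)

* **The verifier** `gapSVPVerifFn ∈ FP` (no machine is written: it is an algebraic expression in
  the bricks of `Computability/Complexity/IntPairBricks.lean`, `IntVectorBricks.lean`). On a pair
  `⟨x, y⟩` it reads off `x` the binary dimension `n`, the row-major list `ents` of entry codes of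
  `B`, and `|num d|`, `den d`; it DECODES THE WITNESS TOTALLY — `zᵢ = ival (elemOf y i)`, every
  string `y` denoting some `z ∈ ℤⁿ` — computes `v = z B` (`Brick.matLoopFn`: `n` row loops with a
  rotating accumulator), `S = ∑ⱼ vⱼ²` (`Brick.sqLoopFn`), and accepts iff `0 < S` and
  `den² · S ≤ num²`, i.e. iff `z B ≠ 0` and `‖z B‖ ≤ d` (`gapSVPVerifFn_encode`: the exact value on
  the code of ANY instance paired with ANY string).
* **Soundness is therefore automatic**: an accepted pair exhibits the nonzero lattice vector
  `z B` of norm `≤ d ≤ γ(n) d < λ₁` on a NO instance (`not_mem_gapSVPVerifLang_of_no`).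
* **Completeness**: an integral shortest vector `u` (`SVP.exists_isSolution_holds`) has
  coefficients `z = u B⁻¹` with `zᵢ det B = det (B with row i replaced by u)` (Cramer), whence
  `|zᵢ| ≤ n! (n M + M)ⁿ` for `M = max |Bₖₗ|` (`|uⱼ| ≤ ‖u‖ ≤ ‖b₀‖ ≤ n M`) and the canonical witness
  `body [dpEnc z₀, …]` has length `≤ 24 (|x| + 1)³` (`exists_short_witness_of_yes`).
* The `NP` language is `{x | dimOf x = 0} ∪ {x | ∃ y, |y| ≤ p |x| ∧ ⟨x, y⟩ accepted}`
  (dimension `0`: every instance is a YES instance and, as `γ(0) ≥ 1 ≥ 0`, none is a NO instance;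
  `lemmaA1DimZero ∈ P` from the Lemma A.1 file).

## References

* D. Aharonov, O. Regev, *Lattice problems in NP ∩ coNP*, J. ACM 52 (2005) 749–765, §1 p. 2.
* O. Regev, *On the complexity of lattice problems with polynomial approximation factors*, in
  *The LLL Algorithm*, Springer 2010, Ch. 15, p. 477.
* D. Micciancio, S. Goldwasser, *Complexity of Lattice Problems*, Kluwer 2002, Ch. 1 §1.2–1.3
  (input size; `GapSVP`), Ch. 1 Thm. 1.1 ff. (integral shortest vectors).
* S. Arora, B. Barak, *Computational Complexity: A Modern Approach*, CUP 2009, Def. 2.1 (NP via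
  certificates), §1.3.
-/

noncomputable section

open Computability Literature.Computability.Complexity Literature.Computability.Complexity.Nondeterministic
open Literature.Computability.Complexity.Brick OracleCompose PRelSigPi Polynomial

namespace Literature.Algebra.EuclideanLattices

open GMSS

/-! ### Projections of the verifier's input `⟨x, y⟩`, `x = ⟨⟨nc, ⟨hm, ents⟩⟩, ⟨⟨sg, num⟩, den⟩⟩` -/

/-- The binary dimension header `nc`. [folklore] -/
def vNcFn : List Bool → List Bool := fstF ∘ fstF ∘ fstF
/-- The row-major list of entry codes `ents`. [folklore] -/
def vEntsFn : List Bool → List Bool := sndPow 1 ∘ fstF ∘ fstF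
/-- The magnitude `|num d|`. [folklore] -/
def vNumFn : List Bool → List Bool := sndF ∘ fstF ∘ sndF ∘ fstF
/-- The denominator `den d`. [folklore] -/
def vDenFn : List Bool → List Bool := sndF ∘ sndF ∘ fstF
/-- The unary dimension `1ⁿ` (binary header converted against the ruler `x`). [folklore] -/
def vOnesFn : List Bool → List Bool := binToUnaryFn ∘ fanoutFn fstF vNcFn
/-- The record handed to the matrix loop: `⟨⟨ents, ⟨y, nc⟩⟩, ⟨nc, ⟨1⁰, ⟨1⁰, body 0ⁿ⟩⟩⟩⟩`. [folklore] -/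
def vZ2Fn : List Bool → List Bool :=
  fanoutFn (fanoutFn vEntsFn (fanoutFn sndF vNcFn))
    (fanoutFn vNcFn (fanoutFn (fun _ => []) (fanoutFn (fun _ => []) (zerosFn ∘ vOnesFn))))
/-- The list code of the vector `v = z B`. [folklore] -/
def vVecFn : List Bool → List Bool := sndPow 3 ∘ matLoopFn ∘ vZ2Fn
/-- The record handed to the squares loop: `⟨v, ⟨nc, ⟨1⁰, ε⟩⟩⟩`. [folklore] -/
def vZ3Fn : List Bool → List Bool := fanoutFn vVecFn (fanoutFn vNcFn (fanoutFn (fun _ => []) fun _ => []))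
/-- The difference pair `S = ∑ⱼ vⱼ²`. [folklore] -/
def vSFn : List Bool → List Bool := sndPow 2 ∘ sqLoopFn ∘ vZ3Fn
/-- `num²`. [folklore] -/
def vNum2Fn : List Bool → List Bool := prodFn ∘ fanoutFn vNumFn vNumFn
/-- `den²`. [folklore] -/
def vDen2Fn : List Bool → List Bool := prodFn ∘ fanoutFn vDenFn vDenFn
/-- `num² + den² · S⁻` (with `S = ⟨S⁺, S⁻⟩`). [folklore] -/
def vLhsFn : List Bool → List Bool := addFn ∘ fanoutFn vNum2Fn (prodFn ∘ fanoutFn vDen2Fn (sndF ∘ vSFn))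
/-- `den² · S⁺`. [folklore] -/
def vRhsFn : List Bool → List Bool := prodFn ∘ fanoutFn vDen2Fn (fstF ∘ vSFn)

/-- **The verifier**: accept iff `0 < S` and not `num² + den² S⁻ < den² S⁺`, i.e. iff
`0 < ‖z B‖²` and `den² ‖z B‖² ≤ num²`. [cite: AharonovRegev2005, §1 p. 2 ("containment in NP is trivial")] -/
def gapSVPVerifFn : List Bool → List Bool :=
  andFn (iposFn ∘ vSFn) (notFn (ltFn ∘ fanoutFn vLhsFn vRhsFn))

/-! ### Polynomial time -/

/-- `vNcFn ∈ FP`. [folklore] -/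
theorem vNcFn_mem_FP : vNcFn ∈ FP := comp_mem_FP fstF_mem_FP (comp_mem_FP fstF_mem_FP fstF_mem_FP)
/-- `vEntsFn ∈ FP`. [folklore] -/
theorem vEntsFn_mem_FP : vEntsFn ∈ FP := comp_mem_FP (sndPow_mem_FP 1) (comp_mem_FP fstF_mem_FP fstF_mem_FP)
/-- `vNumFn ∈ FP`. [folklore] -/
theorem vNumFn_mem_FP : vNumFn ∈ FP :=
  comp_mem_FP sndF_mem_FP (comp_mem_FP fstF_mem_FP (comp_mem_FP sndF_mem_FP fstF_mem_FP))
/-- `vDenFn ∈ FP`. [folklore] -/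
theorem vDenFn_mem_FP : vDenFn ∈ FP := comp_mem_FP sndF_mem_FP (comp_mem_FP sndF_mem_FP fstF_mem_FP)
/-- `vOnesFn ∈ FP`. [folklore] -/
theorem vOnesFn_mem_FP : vOnesFn ∈ FP := comp_mem_FP binToUnaryFn_mem_FP (fanoutFn_mem_FP fstF_mem_FP vNcFn_mem_FP)
/-- `vZ2Fn ∈ FP`. [folklore] -/
theorem vZ2Fn_mem_FP : vZ2Fn ∈ FP :=
  fanoutFn_mem_FP (fanoutFn_mem_FP vEntsFn_mem_FP (fanoutFn_mem_FP sndF_mem_FP vNcFn_mem_FP))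
    (fanoutFn_mem_FP vNcFn_mem_FP (fanoutFn_mem_FP (const_mem_FP _) (fanoutFn_mem_FP (const_mem_FP _)
      (comp_mem_FP zerosFn_mem_FP vOnesFn_mem_FP))))
/-- `vVecFn ∈ FP`. [folklore] -/
theorem vVecFn_mem_FP : vVecFn ∈ FP := comp_mem_FP (sndPow_mem_FP 3) (comp_mem_FP matLoopFn_mem_FP vZ2Fn_mem_FP)
/-- `vZ3Fn ∈ FP`. [folklore] -/
theorem vZ3Fn_mem_FP : vZ3Fn ∈ FP :=
  fanoutFn_mem_FP vVecFn_mem_FP (fanoutFn_mem_FP vNcFn_mem_FP (fanoutFn_mem_FP (const_mem_FP _) (const_mem_FP _)))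
/-- `vSFn ∈ FP`. [folklore] -/
theorem vSFn_mem_FP : vSFn ∈ FP := comp_mem_FP (sndPow_mem_FP 2) (comp_mem_FP sqLoopFn_mem_FP vZ3Fn_mem_FP)
/-- `vNum2Fn ∈ FP`. [folklore] -/
theorem vNum2Fn_mem_FP : vNum2Fn ∈ FP := comp_mem_FP prodFn_mem_FP (fanoutFn_mem_FP vNumFn_mem_FP vNumFn_mem_FP)
/-- `vDen2Fn ∈ FP`. [folklore] -/
theorem vDen2Fn_mem_FP : vDen2Fn ∈ FP := comp_mem_FP prodFn_mem_FP (fanoutFn_mem_FP vDenFn_mem_FP vDenFn_mem_FP)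
/-- `vLhsFn ∈ FP`. [folklore] -/
theorem vLhsFn_mem_FP : vLhsFn ∈ FP :=
  comp_mem_FP addFn_mem_FP (fanoutFn_mem_FP vNum2Fn_mem_FP (comp_mem_FP prodFn_mem_FP
    (fanoutFn_mem_FP vDen2Fn_mem_FP (comp_mem_FP sndF_mem_FP vSFn_mem_FP))))
/-- `vRhsFn ∈ FP`. [folklore] -/
theorem vRhsFn_mem_FP : vRhsFn ∈ FP :=
  comp_mem_FP prodFn_mem_FP (fanoutFn_mem_FP vDen2Fn_mem_FP (comp_mem_FP fstF_mem_FP vSFn_mem_FP))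

/-- **The verifier is polynomial-time**: `gapSVPVerifFn ∈ FP`. [cite: AroraBarakCC2009, §1.3 (closure of polynomial time under composition and bounded loops)] -/
theorem gapSVPVerifFn_mem_FP : gapSVPVerifFn ∈ FP :=
  andFn_mem_FP (comp_mem_FP iposFn_mem_FP vSFn_mem_FP)
    (notFn_mem_FP (comp_mem_FP ltFn_mem_FP (fanoutFn_mem_FP vLhsFn_mem_FP vRhsFn_mem_FP)))

/-- The verifier answers one bit on every input. [folklore] -/
theorem oneBit_gapSVPVerifFn : OneBit gapSVPVerifFn :=
  oneBit_andFn (oneBit_iposFn.comp _) (oneBit_notFn (oneBit_ltFn.comp _))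

/-- Value of the verifier on every input. [folklore] -/
theorem gapSVPVerifFn_apply (w : List Bool) :
    gapSVPVerifFn w = [decide (0 < ival (vSFn w)) &&
      !decide (bitsToNat (vLhsFn w) < bitsToNat (vRhsFn w))] := by
  rw [gapSVPVerifFn, andFn_apply (b := decide (0 < ival (vSFn w)))
    (b' := !decide (bitsToNat (vLhsFn w) < bitsToNat (vRhsFn w)))]
  · simp [Function.comp_apply]
  · rw [notFn_apply (b := decide (bitsToNat (vLhsFn w) < bitsToNat (vRhsFn w)))]
    simp [Function.comp_apply]

/-! ### The verifier's language -/

/-- The `P` language of accepted pairs `⟨x, y⟩`. [cite: AharonovRegev2005, §1 p. 2] -/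
def gapSVPVerifLang : Language Bool := {w | gapSVPVerifFn w = [true]}

/-- **`gapSVPVerifLang ∈ P`.** [cite: AroraBarakCC2009, Def. 1.13 and §1.3] -/
theorem gapSVPVerifLang_mem_P : gapSVPVerifLang ∈ Classes.P :=
  mem_P_of_mem_FP gapSVPVerifFn_mem_FP _ fun w =>
    ⟨fun h => h, fun h => by
      obtain ⟨b, hb⟩ := oneBit_gapSVPVerifFn w
      cases b
      · exact hb
      · exact absurd hb h⟩

/-! ### The value of the verifier on the code of an instance -/

section Decode

variable (I : LatticeInstance) (d : ℚ) (y : List Bool)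

/-- The witness vector DENOTED by an arbitrary string `y` in dimension `n`: `zᵢ = ival (elemOf y i)`.
[folklore] -/
def zOfWitness (n : ℕ) (y : List Bool) : Fin n → ℤ := fun i => ival (elemOf y i)

/-- The integer `‖z B‖²` for the decoded witness. [folklore] -/
def normSqOfWitness : ℤ := ∑ j : Fin I.n, (Matrix.vecMul (zOfWitness I.n y) I.basis j) ^ 2

/-- The two list codes of the tree agree: `frames = body` (`EncodingFrames.foldr_boolPair_eq`).
[folklore] -/
private theorem frames_eq_body (l : List (List Bool)) : frames l = body l := by
  rw [body, foldr_boolPair_eq (fun c : List Bool => c) l, List.map_id']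

/-- The code of `(B, d)`, field by field. [folklore] -/
theorem encode_fields :
    gapSVPInstanceEncoding.encode (I, d) =
      boolPair (boolPair (encodeNat I.n) (boolPair (unaryEncodeNat (I.n * I.n)) (body (rowMajor I.n I.basis))))
        (boolPair (boolPair [decide (d.num < 0)] (encodeNat d.num.natAbs)) (encodeNat d.den)) := by
  rw [gapSVP_encode_eq, frames_eq_body]
  rfl

variable {I d y}

/-- The projections on the code of an instance paired with any string. [folklore] -/
theorem proj_encode (x : List Bool) (hx : x = gapSVPInstanceEncoding.encode (I, d)) :
    vNcFn (boolPair x y) = encodeNat I.n ∧ vEntsFn (boolPair x y) = body (rowMajor I.n I.basis) ∧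
      vNumFn (boolPair x y) = encodeNat d.num.natAbs ∧ vDenFn (boolPair x y) = encodeNat d.den := by
  subst hx
  rw [encode_fields]
  simp [vNcFn, vEntsFn, vNumFn, vDenFn, fstF, sndF, sndPow]

/-- The entry list is long enough to clock the loops: `n ≤ |body (rowMajor n B)|`. [folklore] -/
theorem n_le_length_body_rowMajor (n : ℕ) (B : Matrix (Fin n) (Fin n) ℤ) : n ≤ (body (rowMajor n B)).length := by
  rw [length_body_eq]
  have h : ∀ l : List (List Bool), 2 * l.length ≤ (l.map fun a => 2 * a.length + 2).sum := by
    intro l; induction l with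
    | nil => simp
    | cons a l ih => simp; omega
  have := h (rowMajor n B)
  rw [length_rowMajor] at this
  nlinarith

/-- Entries of the row-major list: position `i n + j` holds the code of `B i j`. [folklore] -/
theorem getElem_rowMajor_entry {n : ℕ} (B : Matrix (Fin n) (Fin n) ℤ) (i j : Fin n)
    (h : (i : ℕ) * n + j < (rowMajor n B).length) :
    (rowMajor n B)[(i : ℕ) * n + j] = encodingIntBool.encode (B i j) := by
  have key : ∀ (l : List (List Bool)), l = (List.ofFn fun k : Fin n => encodingIntBool.encode (B i k)) →
      ∀ (hj : (j : ℕ) < l.length), l[(j : ℕ)] = encodingIntBool.encode (B i j) := by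
    rintro l rfl hj
    simp
  have h2 := key _ (rowMajor_row n B i)
    (by rw [List.length_take, List.length_drop, length_rowMajor]; have := jn_add_n_le n i; omega)
  simp only [List.getElem_take, List.getElem_drop] at h2
  exact h2

/-- Lengths of members of a list code. [folklore] -/
theorem length_le_length_body {l : List (List Bool)} {c : List Bool} (hc : c ∈ l) : c.length ≤ (body l).length := by
  rw [length_body_eq]
  induction l with
  | nil => simp at hc
  | cons a l ih =>
    simp only [List.map_cons, List.sum_cons]
    rcases List.mem_cons.1 hc with rfl | hc'
    · omega
    · have := ih hc'; omega

/-- Entries of the row-major list code, by value: `smval (ents[i n + j]) = B i j`. [folklore] -/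
theorem smval_elemOf_rowMajor {n : ℕ} (B : Matrix (Fin n) (Fin n) ℤ) (i j : Fin n) :
    smval (elemOf (body (rowMajor n B)) (i * n + j)) = B i j := by
  have hlt : (i : ℕ) * n + j < (rowMajor n B).length := by
    rw [length_rowMajor]; exact lt_of_lt_of_le (by omega) (jn_add_n_le n i)
  rw [elemOf_body_of_lt _ hlt, getElem_rowMajor_entry B i j hlt, smval_encode]

/-- The vector computed by the matrix loop is `z B`, entry by entry. [folklore] -/
theorem ival_matAcc_rowMajor (j : Fin I.n) :
    ival ((matAcc (body (rowMajor I.n I.basis)) y I.n I.n).getD j []) =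
      Matrix.vecMul (zOfWitness I.n y) I.basis j := by
  rw [ival_matAcc _ _ _ j.isLt, Matrix.vecMul, dotProduct, Finset.sum_range]
  refine Finset.sum_congr rfl fun i _ => ?_
  rw [smval_elemOf_rowMajor I.basis i j]
  rfl

/-- **The exact value of the verifier on the code of ANY instance paired with ANY string**:
accept iff `0 < ‖z B‖²` and `den(d)² ‖z B‖² ≤ num(d)²` for the witness `z` denoted by `y`.
[cite: AharonovRegev2005, §1 p. 2] -/
theorem gapSVPVerifFn_encode (I : LatticeInstance) (d : ℚ) (y : List Bool) :
    gapSVPVerifFn (boolPair (gapSVPInstanceEncoding.encode (I, d)) y) =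
      [decide (0 < normSqOfWitness I y ∧ (d.den : ℤ) ^ 2 * normSqOfWitness I y ≤ (d.num.natAbs : ℤ) ^ 2)] := by
  obtain ⟨hnc, hents, hnum, hden⟩ := proj_encode (y := y) (gapSVPInstanceEncoding.encode (I, d)) rfl
  have hnx : I.n ≤ (gapSVPInstanceEncoding.encode (I, d)).length := n_le_length_encode_gapSVP I d
  set w := boolPair (gapSVPInstanceEncoding.encode (I, d)) y with hw
  set ents := body (rowMajor I.n I.basis) with hents_def
  -- the unary dimension and the zero vector
  have hones : vOnesFn w = List.replicate I.n true := by
    simp only [vOnesFn, Function.comp_apply, fanoutFn_apply, hnc]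
    rw [hw, show fstF (boolPair (gapSVPInstanceEncoding.encode (I, d)) y) = gapSVPInstanceEncoding.encode (I, d) by
      simp [fstF], binToUnaryFn_boolPair, bitsToNat_encodeNat, min_eq_left hnx]
  have hz2 : vZ2Fn w = boolPair (boolPair ents (boolPair y (encodeNat I.n)))
      (boolPair (encodeNat I.n) (boolPair [] (boolPair [] (body (List.replicate I.n []))))) := by
    simp only [vZ2Fn, fanoutFn_apply, Function.comp_apply, hones, zerosFn_apply, List.length_replicate, hnc, hents]
    rw [hw, show sndF (boolPair (gapSVPInstanceEncoding.encode (I, d)) y) = y by simp [sndF]]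
  have hnents : I.n ≤ ents.length := n_le_length_body_rowMajor I.n I.basis
  have hvec : vVecFn w = body (matAcc ents y I.n I.n) := by
    simp only [vVecFn, Function.comp_apply, hz2, matLoopFn_spec ents y I.n hnents]
    simp [sndPow, sndF]
  set v := body (matAcc ents y I.n I.n) with hv
  have hnv : I.n ≤ v.length := by
    rw [hv, length_body_eq]
    have h : ∀ l : List (List Bool), l.length ≤ (l.map fun a => 2 * a.length + 2).sum := by
      intro l; induction l with
      | nil => simp
      | cons a l ih => simp; omega
    have := h (matAcc ents y I.n I.n)
    rwa [length_matAcc] at this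
  have hS : vSFn w = sqAcc v I.n := by
    simp only [vSFn, Function.comp_apply, vZ3Fn, fanoutFn_apply, hvec, hnc]
    rw [sqLoopFn_spec v I.n hnv]
    simp [sndPow, sndF]
  -- the value of `S`
  have hSval : ival (sqAcc v I.n) = normSqOfWitness I y := by
    rw [ival_sqAcc, normSqOfWitness, Finset.sum_range (fun t => ival (elemOf v t) ^ 2)]
    refine Finset.sum_congr rfl fun j _ => ?_
    rw [hv, elemOf_body_of_lt _ (by rw [length_matAcc]; exact j.isLt), ← List.getD_eq_getElem _ [] _,
      ival_matAcc_rowMajor]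
  -- the final comparison, with `N = |num d|`
  generalize hN : d.num.natAbs = N at hnum ⊢
  have hlhs : bitsToNat (vLhsFn w) = N ^ 2 + d.den ^ 2 * bitsToNat (sndF (sqAcc v I.n)) := by
    simp only [vLhsFn, vNum2Fn, vDen2Fn, Function.comp_apply, fanoutFn_apply, hS, addFn_boolPair, prodFn_boolPair,
      bitsToNat_encodeNat, hnum, hden, sq]
  have hrhs : bitsToNat (vRhsFn w) = d.den ^ 2 * bitsToNat (fstF (sqAcc v I.n)) := by
    simp only [vRhsFn, vDen2Fn, Function.comp_apply, fanoutFn_apply, hS, prodFn_boolPair, bitsToNat_encodeNat, hden, sq]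
  rw [gapSVPVerifFn_apply, hlhs, hrhs, hS, hSval]
  have hPQ : (bitsToNat (fstF (sqAcc v I.n)) : ℤ) - bitsToNat (sndF (sqAcc v I.n)) = normSqOfWitness I y := by
    rw [← hSval]; rfl
  generalize bitsToNat (fstF (sqAcc v I.n)) = P at hPQ ⊢
  generalize bitsToNat (sndF (sqAcc v I.n)) = Q at hPQ ⊢
  generalize normSqOfWitness I y = S at hPQ ⊢
  have key : (N ^ 2 + d.den ^ 2 * Q < d.den ^ 2 * P) ↔ ¬ ((d.den : ℤ) ^ 2 * S ≤ (N : ℤ) ^ 2) := by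
    rw [not_le, ← hPQ, mul_sub]
    constructor
    · intro h
      have h' := (Nat.cast_lt (α := ℤ)).2 h
      push_cast at h'
      linarith
    · intro h
      have h' : ((N ^ 2 + d.den ^ 2 * Q : ℕ) : ℤ) < ((d.den ^ 2 * P : ℕ) : ℤ) := by push_cast; linarith
      exact_mod_cast h'
  by_cases hpos : 0 < S
  · by_cases hle : (d.den : ℤ) ^ 2 * S ≤ (N : ℤ) ^ 2
    · have hlt : ¬ (N ^ 2 + d.den ^ 2 * Q < d.den ^ 2 * P) := fun h => (key.1 h) hle
      simp [hpos, hle, hlt]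
    · have hlt : N ^ 2 + d.den ^ 2 * Q < d.den ^ 2 * P := key.2 hle
      simp [hpos, hle, hlt]
  · simp [hpos]

end Decode

/-! ### Soundness: NO instances have no accepted witness -/

/-- The decoded witness names a lattice vector: `z B ∈ L(B)`, of squared norm `normSqOfWitness`.
[folklore] -/
theorem norm_sq_ofCoeffs_zOfWitness (I : LatticeInstance) (y : List Bool) :
    ‖I.ofCoeffs (zOfWitness I.n y)‖ ^ 2 = (normSqOfWitness I y : ℝ) := by
  rw [LatticeInstance.ofCoeffs, norm_intVecToEuclidean, Real.sq_sqrt (Finset.sum_nonneg fun _ _ => sq_nonneg _),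
    normSqOfWitness]
  push_cast
  rfl

/-- **Soundness**: on the code of a NO instance of `GapSVP_γ` with `γ(n) ≥ 1`, no string is
accepted (the decoded `z B` would be a nonzero lattice vector of norm `≤ d ≤ γ(n) d < λ₁`).
[cite: AharonovRegev2005, §1 p. 2] -/
theorem not_mem_gapSVPVerifLang_of_no {γ : ℕ → ℝ} {I : LatticeInstance} {d : ℚ} (hγ : 1 ≤ γ I.n)
    (h : (I, d) ∈ GapSVP.no γ) (y : List Bool) :
    boolPair (gapSVPInstanceEncoding.encode (I, d)) y ∉ gapSVPVerifLang := by
  intro hacc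
  change gapSVPVerifFn _ = [true] at hacc
  rw [gapSVPVerifFn_encode] at hacc
  have hdec : 0 < normSqOfWitness I y ∧ (d.den : ℤ) ^ 2 * normSqOfWitness I y ≤ (d.num.natAbs : ℤ) ^ 2 :=
    of_decide_eq_true (List.cons.inj hacc).1
  obtain ⟨hI, hd, hlt⟩ := h
  set z := zOfWitness I.n y
  set u := I.ofCoeffs z with hu
  have hu2 : ‖u‖ ^ 2 = (normSqOfWitness I y : ℝ) := norm_sq_ofCoeffs_zOfWitness I y
  have hune : u ≠ 0 := by
    intro h0
    have : (normSqOfWitness I y : ℝ) = 0 := by rw [← hu2, h0, norm_zero]; ring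
    have : normSqOfWitness I y = 0 := by exact_mod_cast this
    omega
  have hmin : minNorm I.lattice ≤ ‖u‖ := minNorm_le_norm_of_mem (I.ofCoeffs_mem_lattice z) hune
  -- `‖u‖ ≤ d`
  have hdpos : (0 : ℝ) < d := by exact_mod_cast hd
  have hnum : (d.num.natAbs : ℤ) = d.num := Int.natAbs_of_nonneg (Rat.num_nonneg.2 hd.le)
  have hud : ‖u‖ ≤ (d : ℝ) := by
    have hden : (0 : ℝ) < d.den := by exact_mod_cast d.den_pos
    have hsq : (d.den : ℝ) ^ 2 * ‖u‖ ^ 2 ≤ (d.num : ℝ) ^ 2 := by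
      rw [hu2]
      have := hdec.2
      rw [hnum] at this
      exact_mod_cast this
    have hd' : (d : ℝ) = d.num / d.den := by exact_mod_cast (Rat.num_div_den d).symm
    rw [hd', le_div_iff₀ hden]
    have hnn : (0 : ℝ) ≤ d.num := by exact_mod_cast Rat.num_nonneg.2 hd.le
    nlinarith [norm_nonneg u, sq_nonneg (‖u‖ * d.den - d.num)]
  have : γ I.n * (d : ℝ) < γ I.n * d := by
    calc γ I.n * (d : ℝ) < minNorm I.lattice := hlt
      _ ≤ ‖u‖ := hmin
      _ ≤ d := hud
      _ ≤ γ I.n * d := le_mul_of_one_le_left hdpos.le hγ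
  exact lt_irrefl _ this

/-! ### Completeness: YES instances have a short accepted witness -/

/-- The canonical witness of a coefficient vector: the list code of its canonical difference
pairs. [folklore] -/
def witnessOf {n : ℕ} (z : Fin n → ℤ) : List Bool := body (List.ofFn fun i => dpEnc (z i))

/-- The canonical witness decodes to the vector. [folklore] -/
theorem zOfWitness_witnessOf {n : ℕ} (z : Fin n → ℤ) : zOfWitness n (witnessOf z) = z := by
  funext i
  rw [zOfWitness, witnessOf, elemOf_body_of_lt _ (by simp)]
  simp

/-- Length of the canonical witness in terms of a bound on the sizes of the entries. [folklore] -/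
theorem length_witnessOf_le {n : ℕ} (z : Fin n → ℤ) {s : ℕ} (hs : ∀ i, (z i).natAbs.size ≤ s) :
    (witnessOf z).length ≤ n * (6 * s + 6) := by
  rw [witnessOf, length_body_eq, List.map_ofFn, List.sum_ofFn]
  have : ∀ i : Fin n, 2 * (dpEnc (z i)).length + 2 ≤ 6 * s + 6 := fun i => by
    have := length_dpEnc_le (z i); have := hs i; omega
  calc ∑ i : Fin n, (2 * (dpEnc (z i)).length + 2) ≤ ∑ _i : Fin n, (6 * s + 6) := Finset.sum_le_sum fun i _ => this i
    _ = n * (6 * s + 6) := by simp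

/-- Determinant bound `|det A| ≤ n! Kⁿ` when all entries are at most `K` in absolute value: Mathlib's
`Matrix.det_le` for the absolute value on `ℤ`. [folklore] -/
theorem abs_det_le {n : ℕ} (A : Matrix (Fin n) (Fin n) ℤ) {K : ℤ} (hK : ∀ i j, |A i j| ≤ K) :
    |A.det| ≤ n.factorial * K ^ n := by
  simpa [nsmul_eq_mul] using Matrix.det_le (abv := AbsoluteValue.abs) hK

/-- Cramer's rule for row vectors: if `z B = v` then `zᵢ · det B = det (B with row i := v)`.
[cite: MicciancioGoldwasser2002, Ch. 1 §1.3] -/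
theorem coeff_mul_det_eq_det_updateRow {n : ℕ} (B : Matrix (Fin n) (Fin n) ℤ) (z v : Fin n → ℤ)
    (h : Matrix.vecMul z B = v) (i : Fin n) : z i * B.det = (B.updateRow i v).det := by
  have hc : B.det • z = Matrix.cramer B.transpose v := by
    rw [Matrix.cramer_eq_adjugate_mulVec, ← h, ← Matrix.mulVec_transpose, Matrix.mulVec_mulVec,
      Matrix.adjugate_mul, Matrix.det_transpose, Matrix.smul_mulVec, Matrix.one_mulVec]
  have := congrFun hc i
  rw [Pi.smul_apply, smul_eq_mul, Matrix.cramer_apply, Matrix.updateCol_transpose, Matrix.det_transpose] at this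
  rw [mul_comm]
  exact this

/-- Coordinates are bounded by the norm: `uₗ² ≤ ∑ₖ uₖ²`. [folklore] -/
theorem sq_apply_le_sum_sq {n : ℕ} (u : Fin n → ℤ) (l : Fin n) : u l ^ 2 ≤ ∑ k, u k ^ 2 :=
  Finset.single_le_sum (f := fun k => u k ^ 2) (fun _ _ => sq_nonneg _) (Finset.mem_univ l)

/-- The squared norm of an integer vector, as an integer. [folklore] -/
theorem norm_sq_intVecToEuclidean (n : ℕ) (u : Fin n → ℤ) :
    ‖intVecToEuclidean n u‖ ^ 2 = ((∑ k, u k ^ 2 : ℤ) : ℝ) := by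
  rw [norm_intVecToEuclidean, Real.sq_sqrt (Finset.sum_nonneg fun _ _ => sq_nonneg _)]
  push_cast
  rfl

/-- **Size of the coefficients of a short vector.** If `z B = u` for a nonsingular `B ∈ ℤⁿˣⁿ` with
entries `≤ M` in absolute value and `∑ uₖ² ≤ n M²`... stated with the bound `K` on the entries of
`u` directly: `|zᵢ| ≤ n! · (max M K)ⁿ`. [cite: MicciancioGoldwasser2002, Ch. 1 §1.3] -/
theorem natAbs_coeff_le {n : ℕ} {B : Matrix (Fin n) (Fin n) ℤ} (hB : B.det ≠ 0) {z u : Fin n → ℤ}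
    (h : Matrix.vecMul z B = u) {K : ℕ} (hM : ∀ i j, (B i j).natAbs ≤ K) (hu : ∀ l, (u l).natAbs ≤ K) (i : Fin n) :
    (z i).natAbs ≤ n.factorial * K ^ n := by
  have hdet : 1 ≤ B.det.natAbs := Nat.one_le_iff_ne_zero.2 (Int.natAbs_ne_zero.2 hB)
  have h1 : (z i).natAbs ≤ (z i).natAbs * B.det.natAbs := Nat.le_mul_of_pos_right _ hdet
  refine h1.trans ?_
  rw [← Int.natAbs_mul, coeff_mul_det_eq_det_updateRow B z u h i]
  have hK : ∀ a b, |(B.updateRow i u) a b| ≤ (K : ℤ) := by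
    intro a b
    rw [Matrix.updateRow_apply]
    split_ifs
    · rw [Int.abs_eq_natAbs]; exact_mod_cast hu b
    · rw [Int.abs_eq_natAbs]; exact_mod_cast hM a b
  have := abs_det_le (B.updateRow i u) hK
  rw [Int.abs_eq_natAbs] at this
  exact_mod_cast this

/-- Sizes of products and powers. [folklore] -/
theorem size_mul_le (a b : ℕ) : (a * b).size ≤ a.size + b.size := by
  rw [Nat.size_le, pow_add]
  exact Nat.mul_lt_mul'' (Nat.lt_size_self a) (Nat.lt_size_self b)

/-- Sizes of powers: `size (aᵏ) ≤ k · size a + 1`. [folklore] -/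
theorem size_pow_le (a k : ℕ) : (a ^ k).size ≤ k * a.size + 1 := by
  induction k with
  | zero => simp
  | succ k ih => rw [pow_succ, Nat.succ_mul]; exact (size_mul_le _ _).trans (by omega)

/-- `n! ≤ nⁿ` in sizes: `size (n!) ≤ n · size n + 1`. [folklore] -/
theorem size_factorial_le (n : ℕ) : n.factorial.size ≤ n * n.size + 1 :=
  (Nat.size_le_size (Nat.factorial_le_pow n)).trans (size_pow_le n n)

/-- **Completeness**: the code of a YES instance of `GapSVP_γ` of positive dimension has an
accepted witness of length `≤ 24 (|x| + 1)³` — the canonical witness of the coefficient vector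
of an integral shortest vector. [cite: AharonovRegev2005, §1 p. 2; MicciancioGoldwasser2002 Ch. 1 §1.3] -/
theorem exists_short_witness_of_yes {γ : ℕ → ℝ} {I : LatticeInstance} {d : ℚ} (hn : I.n ≠ 0)
    (h : (I, d) ∈ GapSVP.yes γ) :
    ∃ y : List Bool, y.length ≤ 24 * ((gapSVPInstanceEncoding.encode (I, d)).length + 1) ^ 3 ∧
      boolPair (gapSVPInstanceEncoding.encode (I, d)) y ∈ gapSVPVerifLang := by
  obtain ⟨hI, hd, hle⟩ := h
  set x := gapSVPInstanceEncoding.encode (I, d) with hx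
  have hn0 : 0 < I.n := Nat.pos_of_ne_zero hn
  -- an integral shortest vector `u` and its coefficients `z`
  obtain ⟨u, hu0, huL, hushort⟩ := SVP.exists_isSolution_holds (γ := fun _ => 1) hI hn le_rfl
  simp only [one_mul] at hushort
  obtain ⟨z, hz⟩ := (I.mem_lattice_iff _).1 huL
  have hzu : Matrix.vecMul z I.basis = u :=
    intVecToEuclidean_injective I.n (by rw [← hz]; rfl)
  refine ⟨witnessOf z, ?_, ?_⟩
  · -- size of the witness
    set M := I.maxEntry with hM
    have i₀ : Fin I.n := ⟨0, hn0⟩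
    -- `|u_l| ≤ n M`: `u_l² ≤ ‖u‖² ≤ ‖b_{i₀}‖² ≤ n M²`
    have hrow : I.vec i₀ ∈ I.lattice ∧ I.vec i₀ ≠ 0 := by
      refine ⟨Submodule.subset_span (Set.mem_range_self i₀), fun h0 => ?_⟩
      exact (LatticeInstance.linearIndependent_vec hI).ne_zero i₀ h0
    have hub : ‖intVecToEuclidean I.n u‖ ≤ ‖I.vec i₀‖ :=
      hushort.trans (minNorm_le_norm_of_mem hrow.1 hrow.2)
    have hsum : ∑ k, u k ^ 2 ≤ ∑ k, I.basis i₀ k ^ 2 := by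
      have h2 : ((∑ k, u k ^ 2 : ℤ) : ℝ) ≤ ((∑ k, I.basis i₀ k ^ 2 : ℤ) : ℝ) := by
        rw [← norm_sq_intVecToEuclidean, ← norm_sq_intVecToEuclidean]
        exact pow_le_pow_left₀ (norm_nonneg _) hub 2
      exact_mod_cast h2
    have hrowsq : ∑ k, I.basis i₀ k ^ 2 ≤ (I.n : ℤ) * (M : ℤ) ^ 2 := by
      calc ∑ k, I.basis i₀ k ^ 2 ≤ ∑ _k : Fin I.n, (M : ℤ) ^ 2 := Finset.sum_le_sum fun k _ => by
            have h1 : |I.basis i₀ k| ≤ (M : ℤ) := by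
              rw [Int.abs_eq_natAbs]; exact_mod_cast I.natAbs_le_maxEntry i₀ k
            nlinarith [abs_nonneg (I.basis i₀ k), sq_abs (I.basis i₀ k)]
        _ = (I.n : ℤ) * (M : ℤ) ^ 2 := by simp
    have hul : ∀ l, (u l).natAbs ≤ I.n * M := by
      intro l
      have h1 := sq_apply_le_sum_sq u l
      have hn1 : (1 : ℤ) ≤ I.n := by exact_mod_cast hn0
      have h5 : u l * u l ≤ ((I.n * M : ℕ) : ℤ) * ((I.n * M : ℕ) : ℤ) := by
        push_cast
        nlinarith [sq_nonneg (M : ℤ), sq_nonneg (u l)]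
      have h6 := Int.natAbs_le_iff_mul_self_le.2 h5
      rwa [Int.natAbs_natCast] at h6
    have hK : ∀ a b, (I.basis a b).natAbs ≤ I.n * M := fun a b =>
      (I.natAbs_le_maxEntry a b).trans (Nat.le_mul_of_pos_left M hn0)
    have hzi : ∀ i, (z i).natAbs ≤ (I.n).factorial * (I.n * M) ^ I.n := natAbs_coeff_le hI hzu hK hul
    -- sizes against `|x|`
    have hnx : I.n ≤ x.length := n_le_length_encode_gapSVP I d
    have hsn : (I.n).size ≤ x.length := Nat.size_le.2 (lt_of_le_of_lt hnx Nat.lt_two_pow_self)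
    have hents : (body (rowMajor I.n I.basis)).length ≤ x.length := by
      rw [hx, encode_fields]
      simp only [length_boolPair]
      omega
    have hsM : M.size ≤ x.length := by
      -- `M = |B a b|` for some entry, whose code sits inside `x`
      obtain ⟨⟨a, b⟩, -, hab⟩ := Finset.exists_mem_eq_sup (Finset.univ : Finset (Fin I.n × Fin I.n))
        ⟨(i₀, i₀), Finset.mem_univ _⟩ (fun ij : Fin I.n × Fin I.n => (I.basis ij.1 ij.2).natAbs)
      have hMab : M = (I.basis a b).natAbs := hab
      have hlt : (a : ℕ) * I.n + b < (rowMajor I.n I.basis).length := by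
        rw [length_rowMajor]; exact lt_of_lt_of_le (by omega) (jn_add_n_le I.n a)
      have hmem : encodingIntBool.encode (I.basis a b) ∈ rowMajor I.n I.basis := by
        rw [← getElem_rowMajor_entry I.basis a b hlt]; exact List.getElem_mem hlt
      have hlen := length_le_length_body hmem
      rw [length_encodingIntBool_encode, TM2Pass.length_encodeNat_eq_size, ← hMab] at hlen
      omega
    have hs : ∀ i, (z i).natAbs.size ≤ 3 * x.length ^ 2 + 2 := by
      intro i
      refine (Nat.size_le_size (hzi i)).trans ((size_mul_le _ _).trans ?_)
      have h1 := size_factorial_le I.n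
      have h2 : ((I.n * M) ^ I.n).size ≤ I.n * ((I.n).size + M.size) + 1 :=
        (size_pow_le _ _).trans (Nat.add_le_add_right (Nat.mul_le_mul_left _ (size_mul_le _ _)) 1)
      have h3 : I.n * (I.n).size ≤ x.length * x.length := Nat.mul_le_mul hnx hsn
      have h4 : I.n * ((I.n).size + M.size) ≤ x.length * (x.length + x.length) :=
        Nat.mul_le_mul hnx (Nat.add_le_add hsn hsM)
      have e1 : x.length * (x.length + x.length) = 2 * (x.length * x.length) := by ring
      have e2 : x.length ^ 2 = x.length * x.length := sq _
      rw [e1] at h4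
      rw [e2]
      omega
    have hw := length_witnessOf_le z hs
    have hfin : I.n * (6 * (3 * x.length ^ 2 + 2) + 6) ≤ 24 * (x.length + 1) ^ 3 := by
      have h1 : I.n * (6 * (3 * x.length ^ 2 + 2) + 6) ≤ x.length * (6 * (3 * x.length ^ 2 + 2) + 6) :=
        Nat.mul_le_mul_right _ hnx
      have e1 : x.length * (6 * (3 * x.length ^ 2 + 2) + 6) = 18 * x.length ^ 3 + 18 * x.length := by ring
      have e2 : 24 * (x.length + 1) ^ 3 = 24 * x.length ^ 3 + 72 * x.length ^ 2 + 72 * x.length + 24 := by ring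
      rw [e1] at h1
      rw [e2]
      omega
    exact hw.trans hfin
  · -- acceptance
    change gapSVPVerifFn _ = [true]
    rw [gapSVPVerifFn_encode]
    refine congrArg (fun b => [b]) (decide_eq_true ?_)
    have hzw : zOfWitness I.n (witnessOf z) = z := zOfWitness_witnessOf z
    have hS : normSqOfWitness I (witnessOf z) = ∑ k, u k ^ 2 := by
      rw [normSqOfWitness, hzw, hzu]
    rw [hS]
    constructor
    · -- `u ≠ 0`
      obtain ⟨l, hl⟩ : ∃ l, u l ≠ 0 := by
        by_contra hall
        push Not at hall
        exact hu0 (funext hall)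
      have := sq_apply_le_sum_sq u l
      have : 0 < u l ^ 2 := by positivity
      omega
    · -- `den² ‖u‖² ≤ num²`, from `‖u‖ ≤ λ₁ ≤ d`
      have hud : ‖intVecToEuclidean I.n u‖ ≤ d := hushort.trans hle
      have hnum : (d.num.natAbs : ℤ) = d.num := Int.natAbs_of_nonneg (Rat.num_nonneg.2 hd.le)
      rw [hnum]
      have hd' : (d : ℝ) = d.num / d.den := by exact_mod_cast (Rat.num_div_den d).symm
      have hden : (0 : ℝ) < d.den := by exact_mod_cast d.den_pos
      have h1 : ‖intVecToEuclidean I.n u‖ * d.den ≤ d.num := by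
        rw [hd', le_div_iff₀ hden] at hud; exact hud
      have h2 : (‖intVecToEuclidean I.n u‖ * d.den) ^ 2 ≤ (d.num : ℝ) ^ 2 :=
        pow_le_pow_left₀ (by positivity) h1 2
      rw [mul_pow, norm_sq_intVecToEuclidean] at h2
      have h3 : ((d.den : ℤ) : ℝ) ^ 2 * ((∑ k, u k ^ 2 : ℤ) : ℝ) ≤ ((d.num : ℤ) : ℝ) ^ 2 := by
        have : ((d.den : ℤ) : ℝ) = (d.den : ℝ) := by norm_cast
        rw [this]; linarith
      exact_mod_cast h3

/-! ### The `NP` language and the discharge -/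

/-- The witness-length polynomial `24 (X + 1)³`. [folklore] -/
def gapSVPWitnessPoly : Polynomial ℕ := 24 * (X + 1) ^ 3

/-- Evaluation of the witness-length polynomial. [folklore] -/
@[simp] theorem gapSVPWitnessPoly_eval (m : ℕ) : gapSVPWitnessPoly.eval m = 24 * (m + 1) ^ 3 := by
  simp [gapSVPWitnessPoly]

/-- **The `NP` language separating `GapSVP_γ`** (`γ ≥ 1`): strings of dimension `0`, or strings
with an accepted witness of polynomial length. [cite: AharonovRegev2005, §1 p. 2] -/
def gapSVPNPLang : Language Bool :=
  lemmaA1DimZero ⊔ {x | ∃ y : List Bool, y.length ≤ gapSVPWitnessPoly.eval x.length ∧ boolPair x y ∈ gapSVPVerifLang}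

/-- **`gapSVPNPLang ∈ NP`** (a `P` language, union a language in certificate form over the `P`
verifier). [cite: AroraBarakCC2009, Def. 2.1] -/
theorem gapSVPNPLang_mem_NP : gapSVPNPLang ∈ Nondeterministic.NP :=
  union_P_mem_polyExists (K := Classes.P) (fun _ _ a b => union_mem_P a b) lemmaA1DimZero_mem_P
    ⟨gapSVPVerifLang, gapSVPVerifLang_mem_P, gapSVPWitnessPoly, fun _ => Iff.rfl⟩

/-- **`GapSVP_γ ∈ PromiseNP` for every factor `γ ≥ 1`** (`gapSVP_mem_promiseNP`, DISCHARGED):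
the `NP` language `gapSVPNPLang` contains the code of every YES instance (dimension `0`, or the
canonical witness of an integral shortest vector, `exists_short_witness_of_yes`) and of no NO
instance (positive dimension is forced by `γ(0) ≥ 0`; soundness of the verifier,
`not_mem_gapSVPVerifLang_of_no`). [cite: AharonovRegev2005, §1 p. 2 ("containment in NP is trivial")] -/
theorem gapSVP_mem_promiseNP_holds : gapSVP_mem_promiseNP := by
  intro γ hγ
  refine ⟨gapSVPNPLang, gapSVPNPLang_mem_NP, ?_, ?_⟩
  · rintro x hx
    rw [gapSVPPromise_yes] at hx
    obtain ⟨⟨I, d⟩, hp, rfl⟩ := hx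
    by_cases h0 : I.n = 0
    · left
      change dimOf (gapSVPInstanceEncoding.encode (I, d)) = 0
      rw [dimOf_encode, h0]
    · right
      obtain ⟨y, hy, hacc⟩ := exists_short_witness_of_yes h0 hp
      exact ⟨y, by rwa [gapSVPWitnessPoly_eval], hacc⟩
  · rintro x hx
    rw [gapSVPPromise_no] at hx
    obtain ⟨⟨I, d⟩, hp, rfl⟩ := hx
    rintro (h | ⟨y, -, hacc⟩)
    · have h0 : I.n ≠ 0 := fun h0 => not_mem_gapSVP_no_of_n_eq_zero γ (zero_le_one.trans (hγ 0)) h0 d hp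
      change dimOf (gapSVPInstanceEncoding.encode (I, d)) = 0 at h
      rw [dimOf_encode] at h
      exact h0 h
    · exact not_mem_gapSVPVerifLang_of_no (hγ I.n) hp y hacc

/-- **Aharonov–Regev 2005, Cor. 1.2 from the coNP part of Thm. 1.1 alone**: with the NP leaf and
Lemma A.1 discharged, `gapSVP_sqrt_mem_promiseNP_inter_promiseCoNP` follows from
`gapCVP_sqrt_mem_promiseCoNP`. [cite: AharonovRegev2005, Cor. 1.2 (p. 2), from Thm. 1.1 and Lemma A.1 (p. 14)] -/
theorem gapSVP_sqrt_mem_promiseNP_inter_promiseCoNP_of_coNP_part (h11 : gapCVP_sqrt_mem_promiseCoNP) :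
    gapSVP_sqrt_mem_promiseNP_inter_promiseCoNP :=
  gapSVP_sqrt_mem_promiseNP_inter_promiseCoNP_of_NP_of_coNP gapSVP_mem_promiseNP_holds h11

end Literature.Algebra.EuclideanLattices

end
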